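import Summits.HodgeConjecture.HodgeConjecture.Theses.RankFourFaces
import Summits.HodgeConjecture.HodgeConjecture.Theorems.AnchorTransportVariationalHodgeReductions
import Summits.HodgeConjecture.HodgeConjecture.Theorems.AnchorTransportVariationalHodgeClosing
import Summits.HodgeConjecture.HodgeConjecture.Theorems.AnchorTransportVariationalHodgeDominance
import Summits.HodgeConjecture.HodgeConjecture.Theorems.AnchorTransportVariationalHodgeQuasiProjective
import Literature.AlgebraicGeometry.HodgeTheory.AlgebraicityLocusIUnionClosedProofs
import Literature.AlgebraicGeometry.HodgeTheory.QuasiProjectiveOfAffine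

/-!
# Birth skeleton — crux `RankFourWeilTransport` (stmt-HodgeConjecture-16265), route `RankFourFaces`

BC3 skeleton (registrar seat `planner-skel-stmt-HodgeConjecture-16265-0`, 2026-08-17) for the rank-2 crux
`Summit.HodgeConjecture.HodgeConjecture.Theses.RankFourFaces.RankFourWeilTransport`: Grothendieck's
variational Hodge statement for DEGREE-FOUR classes on smooth projective families `f : 𝒳 ⟶ S`
(`S` smooth irreducible) all of whose complex fibres are abelian `4g`-folds carrying an endomorphism
`φ'` with `P(φ') = 0` (`P` monic of degree `2g`, irreducible over `ℚ`, no real root, polynomial complex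
conjugation: `E = ℚ[T]/(P)` a CM field acting with `E`-rank `4`) — a global `W ∈ H⁴(𝒳(ℂ); ℂ)` with
rational `(2,2)` fibre restrictions, algebraic on ONE fibre, is algebraic on EVERY fibre.

## The cut (two named stubs, composed by `RankFourWeilTransport_of`)

Every engine proposed for this crux (Markman-type semiregular secant sheaves deformed over the Hodge
locus, Buchweitz–Flenner / Pridham; normal functions; the idea cards `rank-four-purity-nl-seeds`,
`schoen-prym-anchors-rank-four` attached to the item) delivers algebraicity on an ANALYTIC
NEIGHBOURHOOD of a good fibre of a PROJECTIVE family over a small base. The skeleton isolates exactly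
the two things that separate that output from the crux as typed:

* `stub_locallyProjective` (S1, abelian-specific, a THEOREM to be proved, size M/L): a smooth projective
  family (`IsSmoothProjectiveFamily`: smooth + proper + smooth projective fibres — NOT a projective
  morphism in general, Atiyah-flop families of K3 surfaces) over a smooth base all of whose complex
  fibres are underlying varieties of abelian varieties is, Zariski-locally on the base, a family with
  QUASI-PROJECTIVE total space: every complex point `s` has an affine open `U ∋ pt s` with
  `𝒳 ×_S U` quasi-projective over `ℂ`. Proof sketch: the generic fibre is projective (spread an ample
  bundle from a complex fibre over the generic point of a model over a finitely generated field; norm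
  descent), an ample divisor of the generic fibre extends to a line bundle `L` near `s` (`𝒳` is regular),
  `c₁(L)` is a flat section whose Hermitian form is positive definite at the very general nearby fibres
  (openness of ampleness, EGA III 4.7.1) hence positive SEMI-definite and non-degenerate — so positive
  definite — on the complex torus `𝒳_s`: `L_s` is ample, `L` is `f`-ample over a neighbourhood
  (EGA III 4.7.1), and a proper family with an `f`-ample bundle over an affine of finite type has
  quasi-projective total space (`isQuasiProjectiveOver_of_isClosedImmersion_of_isAffine`). FALSE for
  general fibres (Atiyah 1958), so the abelian hypothesis of the crux is used here and only here.
* `stub_localTransport` (S2, THE BET, research-open): for the crux's families with, in addition,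
  quasi-projective total space over a smooth irreducible AFFINE base, one algebraic fibre forces
  algebraicity of `W|_{𝒳_t}` for all `t` in some NON-EMPTY EUCLIDEAN-OPEN subset of `S(ℂ)` — the local
  variational Hodge statement in the rank-four Weil sector, the socket every deformation-theoretic
  engine plugs into (Bloch 1972 / Buchweitz–Flenner 2003 give it at a fibre carrying a semiregular
  representative; Markman's secant sheaves are the candidate representatives, arXiv:2509.23403 §§4–5,
  §12).

`RankFourWeilTransport_of : S1 → S2 → RankFourWeilTransport` is PROVED below (no `sorry`), and the
proof is not a one-liner: chain `s₀ → u → s` through two S1-opens `U₀ ∋ pt s₀`, `U ∋ pt s` meeting in a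
complex point `u` (irreducibility + Jacobson), restrict the family to each open (`Motives.familyPullback`,
moving fibres, `E`-structures, the class, its Hodge data and the anchor across
`fiberOverFamilyPullbackIso`), run S2 there, and close with the tree's DISCHARGED Hilbert-scheme fact
`charlesSchnell_algebraicityLocus_iUnion_closed_holds` + Baire (`variationalHodge_conclusion_of_isOpen`:
algebraic on a non-empty Euclidean open of a smooth irreducible quasi-projective base ⟹ algebraic
everywhere).

## Honesty box

* WHERE THE DIFFICULTY SITS. S2 is the crux's analytic-local core and carries essentially all of its
  difficulty; S1 is a genuine but provable scheme-theoretic input. This is not shredding: S2 is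
  strictly LOCAL (an open set somewhere in `S(ℂ)`, not every fibre), strictly SMALLER in scope
  (quasi-projective total space, affine base), and the passage S2 ⇒ crux consumes S1, the locus theorem
  (1 600 lines of the tree) and Baire. The converse crux ⇒ S2 is immediate (take `V = S(ℂ)`), as for
  any special case.
* NO STUB IS REFUTABLE SHORT OF ¬HC: S1 is a theorem (sketch above); S2 is implied fibrewise by the
  Hodge conjecture (`V = S(ℂ)`). Neither is the crux or the summit in costume: the BC3 probes
  `stub → RankFourWeilTransport`, `stub → HodgeConjecture` by `first | exact? | simpa | aesop` fail for
  both (registrar folder `bc/RankFourWeilTransport_probes.lean`, quoted in `Lines/birth.md`).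
* REJECTED CUTS. (a) "algebraicity locus = countable union of Zariski-closed sets" as a stub: it is the
  tree's PROVED `charlesSchnell_algebraicityLocus_iUnion_closed_holds` in the quasi-projective case and
  pathology-prone (uncountably many affine charts) in the crux's generality — used by name instead;
  (b) "Baire closing" as a stub: proved in the tree (`not_subset_iUnion_of_interior_nonempty`,
  `variationalHodge_conclusion_of_isOpen`) — used by name; (c) a representation-theoretic stub "off the
  `E`-Weil line every flat `(2,2)` class is divisor-generated": FALSE for the special families the crux
  quantifies over (constant families, families inside special subvarieties); (d) semiregular-seed stubs:
  engine-specific and constrained by the 2001 negative answer to Markman's Q11.4 (item evidence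
  BARRIERS.md, B2) — they belong to crux-plan lines plugging into S2, not to the birth certificate.
* Disproof used: none — `Cruxes/RankFourWeilTransport/` has no `Disproof.lean` (no `_false_without_`
  theorem to honour) at registration; the standing disproof of the sibling crux
  `AnchorTransport.VariationalHodge` (`Cruxes/VariationalHodge/Disproof.lean`: the ANCHOR carries
  everything, base hypotheses are not load-bearing, non-separated bases are harmless) is honoured: both
  stubs keep the anchor, and the reduction to affine bases is done in the proved glue, not assumed.
  `ledger negatives --problem HodgeConjecture`: nothing of the shape of S1/S2.
-/

set_option linter.dupNamespace false

noncomputable section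

open CategoryTheory AlgebraicGeometry TopologicalSpace
open Literature.AlgebraicGeometry.Motives Literature.AlgebraicGeometry.HodgeTheory
open Summit.HodgeConjecture.HodgeConjecture.Theses.RankFourFaces
open Summit.HodgeConjecture.HodgeConjecture.Theorems

namespace Summit.HodgeConjecture.HodgeConjecture.Cruxes.RankFourWeilTransport.Birth

/-! ## §1 Statements of the stubs -/

/-- Statement of STUB S1 — **ABELIAN-FIBRED SMOOTH PROJECTIVE FAMILIES ARE ZARISKI-LOCALLY
QUASI-PROJECTIVE.** For `f : 𝒳 ⟶ S` a smooth projective family of relative dimension `n`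
(`IsSmoothProjectiveFamily`: smooth of relative dimension `n`, proper, smooth projective complex fibres)
over a `ℂ`-scheme `S` smooth over `ℂ`, all of whose complex fibres are isomorphic to underlying varieties
of complex abelian varieties: every complex point `s` of `S` lies in an affine open `U ⊆ S` such that the
total space `𝒳 ×_S U` of the restricted family is quasi-projective over `ℂ`. Why plausibly true: the
generic fibre is projective; an ample divisor of it extends to a line bundle `L` on `𝒳` near `s` (`𝒳`
regular); `c₁(L)` is flat, positive definite on very general nearby fibres (openness of ampleness), hence
positive semi-definite AND non-degenerate on the complex torus `𝒳_s`, i.e. `L_s` is ample; so `L` is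
`f`-ample over an affine neighbourhood `U` (EGA III 4.7.1) and `𝒳 ×_S U ↪ ℙᴺ × U` is closed with
`ℙᴺ × U` quasi-projective. Why it might fail: only by mis-typing — for NON-abelian fibres it is false
(Atiyah-flop families), which is why the fibre hypothesis is kept. -/
def LocallyProjective : Prop :=
  ∀ (n : ℕ) ⦃𝒳 S : SchemeOver ℂ⦄ (f : 𝒳 ⟶ S), IsSmoothProjectiveFamily f n →
    AlgebraicGeometry.Smooth S.hom →
    (∀ s : ComplexPoints S, ∃ A' : AbelianVariety ℂ, Nonempty (A'.X ≅ fiberOver f s)) →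
    ∀ s : ComplexPoints S, ∃ U : S.left.Opens, IsAffineOpen U ∧ s.pt ∈ U ∧
      IsQuasiProjectiveOver (familyPullback f (openSubschemeOverι S U))

/-- Statement of STUB S2 — **LOCAL TRANSPORT IN THE RANK-FOUR WEIL SECTOR** (the bet). The crux's
data verbatim — `g ≥ 2`; `P ∈ ℤ[T]` monic of degree `2g`, irreducible over `ℚ`, without real roots, with
polynomial complex conjugation; a smooth projective family `f : 𝒳 ⟶ S` of relative dimension `4g` over a
smooth irreducible base, every complex fibre `≅ (A', φ')` with `A'.dim = 4g`, `P(φ') = 0`; a global class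
`W ∈ H⁴(𝒳(ℂ); ℂ)` with rational `(2,2)` fibre restrictions; an algebraic anchor fibre — PLUS
quasi-projectivity of the total space `𝒳` and an AFFINE base: then `W|_{𝒳_t}` is algebraic for every
`t` in some non-empty Euclidean-open subset `V ⊆ S(ℂ)`. Why it might fail: it is the local variational
Hodge statement in codimension `2` on abelian `4g`-folds, `g ≥ 2` — open; known only at fibres carrying a
semiregular representative (Bloch 1972; Buchweitz–Flenner 2003, Thm. 5.2), and no semiregular
representative of a rank-four `E`-Weil class is known for `[E:ℚ] > 2` (Markman, arXiv:2509.23403 §12);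
it is implied fibrewise by the Hodge conjecture, so it dies only with HC. -/
def LocalTransport : Prop :=
  ∀ (g : ℕ), 2 ≤ g → ∀ (P : Polynomial ℤ), P.Monic → P.natDegree = 2 * g →
    Irreducible (P.map (Int.castRingHom ℚ)) →
    (∀ ρ : ℂ, Polynomial.eval₂ (Int.castRingHom ℂ) ρ P = 0 → ρ.im ≠ 0) →
    (∃ Q : Polynomial ℚ, ∀ ρ : ℂ, Polynomial.eval₂ (Int.castRingHom ℂ) ρ P = 0 →
      Polynomial.aeval ρ Q = (starRingEnd ℂ) ρ) →
    ∀ ⦃𝒳 S : SchemeOver ℂ⦄ (f : 𝒳 ⟶ S), IsSmoothProjectiveFamily f (4 * g) →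
    IsQuasiProjectiveOver 𝒳 → IsAffine S.left → IrreducibleSpace S.left →
    AlgebraicGeometry.Smooth S.hom →
    (∀ s : ComplexPoints S, ∃ (A' : AbelianVariety ℂ) (φ' : A' ⟶ A'), A'.dim = 4 * g ∧
      Polynomial.eval₂ (Int.castRingHom (CategoryTheory.End A')) (φ' : CategoryTheory.End A') P = 0 ∧
      Nonempty (A'.X ≅ fiberOver f s)) →
    ∀ (W : complexBetti 𝒳 4),
    (∀ s : ComplexPoints S, IsRationalClass (complexBetti.map (fiberι f s) 4 W) ∧
      IsOfHodgeType (4 * g) (fiberOver f s) 4 2 2 (complexBetti.map (fiberι f s) 4 W)) →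
    (∃ s₀ : ComplexPoints S,
      complexBetti.map (fiberι f s₀) 4 W ∈ algebraicClasses (fiberOver f s₀) 2) →
    ∃ V : Set (ComplexPoints S), IsOpen V ∧ V.Nonempty ∧
      ∀ t ∈ V, complexBetti.map (fiberι f t) 4 W ∈ algebraicClasses (fiberOver f t) 2

/-! ## §2 The stubs (the ONLY `sorry`s of this file) -/

/-- STUB S1 (registered): abelian-fibred smooth projective families are Zariski-locally
quasi-projective, `LocallyProjective`. -/
theorem stub_locallyProjective : LocallyProjective := by
  sorry

/-- STUB S2 (registered): local transport in the rank-four Weil sector, `LocalTransport`. -/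
theorem stub_localTransport : LocalTransport := by
  sorry

/-! ### Name-keyed aliases (the skeleton audit admits a hypothesis of `RankFourWeilTransport_of` iff
the head constant of its type has the short name of a declared stub) -/
namespace Registered

/-- Alias of `LocallyProjective` keyed by the registered stub name. -/
abbrev stub_locallyProjective : Prop := LocallyProjective
/-- Alias of `LocalTransport` keyed by the registered stub name. -/
abbrev stub_localTransport : Prop := LocalTransport

end Registered

/-! ## §3 Composition (no `sorry` below this line) -/

section Glue

variable {g : ℕ} {P : Polynomial ℤ} {𝒳 S : SchemeOver ℂ}

/-- **One step inside an S1-open.** Granted S2: for the crux's data over a smooth irreducible `S` and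
an affine open `U ⊆ S` over which the total space `𝒳 ×_S U` is quasi-projective, algebraicity of
`W|_{𝒳_a}` passes to `W|_{𝒳_b}` whenever `pt a, pt b ∈ U`. Restrict the family to `U`
(`Motives.familyPullback` along `openSubschemeOverι S U`: again a smooth projective family, fibres and
their `E`-structures moved across `fiberOverFamilyPullbackIso`, the class pulled back, its fibrewise
Hodge data and the anchor moved by `familyPullback_fibrewise_rational_hodgeType` /
`map_fiberι_familyPullback_mem_algebraicClasses_iff`), get from S2 a non-empty Euclidean open of `U(ℂ)`
in the algebraicity locus, and close on the quasi-projective family over the smooth irreducible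
quasi-projective `U` with the tree's `variationalHodge_conclusion_of_isOpen` (the DISCHARGED fact
`charlesSchnell_algebraicityLocus_iUnion_closed_holds` + Baire). -/
theorem step_of_localTransport (h₂ : LocalTransport) (hg : 2 ≤ g) (hPm : P.Monic)
    (hPd : P.natDegree = 2 * g) (hPi : Irreducible (P.map (Int.castRingHom ℚ)))
    (hPr : ∀ ρ : ℂ, Polynomial.eval₂ (Int.castRingHom ℂ) ρ P = 0 → ρ.im ≠ 0)
    (hPc : ∃ Q : Polynomial ℚ, ∀ ρ : ℂ, Polynomial.eval₂ (Int.castRingHom ℂ) ρ P = 0 →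
      Polynomial.aeval ρ Q = (starRingEnd ℂ) ρ)
    (f : 𝒳 ⟶ S) (hf : IsSmoothProjectiveFamily f (4 * g)) [IrreducibleSpace S.left]
    [AlgebraicGeometry.Smooth S.hom]
    (hfib : ∀ s : ComplexPoints S, ∃ (A' : AbelianVariety ℂ) (φ' : A' ⟶ A'), A'.dim = 4 * g ∧
      Polynomial.eval₂ (Int.castRingHom (CategoryTheory.End A')) (φ' : CategoryTheory.End A') P = 0 ∧
      Nonempty (A'.X ≅ fiberOver f s))
    (W : complexBetti 𝒳 4)
    (hW : ∀ s : ComplexPoints S, IsRationalClass (complexBetti.map (fiberι f s) 4 W) ∧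
      IsOfHodgeType (4 * g) (fiberOver f s) 4 2 2 (complexBetti.map (fiberι f s) 4 W))
    (U : S.left.Opens) (hU : IsAffineOpen U)
    (hq : IsQuasiProjectiveOver (familyPullback f (openSubschemeOverι S U)))
    (a b : ComplexPoints S) (haU : a.pt ∈ U) (hbU : b.pt ∈ U)
    (ha : complexBetti.map (fiberι f a) 4 W ∈ algebraicClasses (fiberOver f a) 2) :
    complexBetti.map (fiberι f b) 4 W ∈ algebraicClasses (fiberOver f b) 2 := by
  -- the affine open `U` as a smooth irreducible affine (hence quasi-projective) `ℂ`-scheme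
  haveI : IsOpenImmersion (openSubschemeOverι S U).left := inferInstanceAs (IsOpenImmersion U.ι)
  haveI hUaff : IsAffine (openSubschemeOver S U).left := hU
  haveI hUirr : IrreducibleSpace (openSubschemeOver S U).left := by
    change IrreducibleSpace U
    exact isIrreducible_iff_irreducibleSpace.mp ⟨⟨a.pt, haU⟩,
      (PreirreducibleSpace.isPreirreducible_univ (X := S.left)).open_subset U.isOpen
        (Set.subset_univ _)⟩
  haveI hUsm : AlgebraicGeometry.Smooth (openSubschemeOver S U).hom := by
    change AlgebraicGeometry.Smooth (U.ι ≫ S.hom)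
    infer_instance
  haveI : LocallyOfFiniteType (openSubschemeOver S U).hom := by
    change LocallyOfFiniteType (U.ι ≫ S.hom)
    infer_instance
  have hUqp : IsQuasiProjectiveOver (openSubschemeOver S U) := IsQuasiProjectiveOver.of_isAffine _
  -- lift `a`, `b` to `U`
  have hrange : Set.range (AlgPoints.map (L := ℂ) (openSubschemeOverι S U)) = {Q | Q.pt ∈ U} := by
    rw [AlgPoints.range_map_of_isOpenImmersion_holds]
    ext Q
    change Q.pt ∈ U.ι.opensRange ↔ Q.pt ∈ U
    rw [Scheme.Opens.opensRange_ι]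
  obtain ⟨a', rfl⟩ : a ∈ Set.range (AlgPoints.map (L := ℂ) (openSubschemeOverι S U)) := by
    rw [hrange]; exact haU
  obtain ⟨b', rfl⟩ : b ∈ Set.range (AlgPoints.map (L := ℂ) (openSubschemeOverι S U)) := by
    rw [hrange]; exact hbU
  -- the restricted family `f' : 𝒳 ×_S U ⟶ U` and its data
  have hf' : IsSmoothProjectiveFamily (familyPullback.snd f (openSubschemeOverι S U)) (4 * g) :=
    hf.familyPullback_snd _
  have hfib' : ∀ s' : ComplexPoints (openSubschemeOver S U), ∃ (A' : AbelianVariety ℂ) (φ' : A' ⟶ A'),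
      A'.dim = 4 * g ∧
      Polynomial.eval₂ (Int.castRingHom (CategoryTheory.End A')) (φ' : CategoryTheory.End A') P = 0 ∧
      Nonempty (A'.X ≅ fiberOver (familyPullback.snd f (openSubschemeOverι S U)) s') := by
    intro s'
    obtain ⟨A', φ', hd, hP, ⟨e⟩⟩ := hfib (AlgPoints.map (openSubschemeOverι S U) s')
    exact ⟨A', φ', hd, hP, ⟨e ≪≫ (fiberOverFamilyPullbackIso f (openSubschemeOverι S U) s').symm⟩⟩
  have hW' : ∀ s' : ComplexPoints (openSubschemeOver S U),
      IsRationalClass (complexBetti.map (fiberι (familyPullback.snd f (openSubschemeOverι S U)) s') 4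
        (complexBetti.map (familyPullback.fst f (openSubschemeOverι S U)) 4 W)) ∧
      IsOfHodgeType (4 * g) (fiberOver (familyPullback.snd f (openSubschemeOverι S U)) s') 4 2 2
        (complexBetti.map (fiberι (familyPullback.snd f (openSubschemeOverι S U)) s') 4
          (complexBetti.map (familyPullback.fst f (openSubschemeOverι S U)) 4 W)) :=
    fun s' => familyPullback_fibrewise_rational_hodgeType (n := 4 * g) (p := 2) f
      (openSubschemeOverι S U) W hW s'
  have ha' : complexBetti.map (fiberι (familyPullback.snd f (openSubschemeOverι S U)) a') 4
      (complexBetti.map (familyPullback.fst f (openSubschemeOverι S U)) 4 W) ∈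
        algebraicClasses (fiberOver (familyPullback.snd f (openSubschemeOverι S U)) a') 2 :=
    (map_fiberι_familyPullback_mem_algebraicClasses_iff (p := 2) f (openSubschemeOverι S U) hf W a').2 ha
  -- S2 on `U`: a non-empty Euclidean open of `U(ℂ)` inside the algebraicity locus
  obtain ⟨V, hV, hVne, hValg⟩ := h₂ g hg P hPm hPd hPi hPr hPc
    (familyPullback.snd f (openSubschemeOverι S U)) hf' hq hUaff hUirr hUsm hfib'
    (complexBetti.map (familyPullback.fst f (openSubschemeOverι S U)) 4 W) hW' ⟨a', ha'⟩
  -- local-to-global over the quasi-projective `U` (locus theorem + Baire), and back to `S`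
  have hb' := variationalHodge_conclusion_of_isOpen (p := 2)
    (familyPullback.snd f (openSubschemeOverι S U)) charlesSchnell_algebraicityLocus_iUnion_closed_holds
    hq hUqp hUsm hUirr hf' (complexBetti.map (familyPullback.fst f (openSubschemeOverι S U)) 4 W)
    hV hVne hValg b'
  exact (map_fiberι_familyPullback_mem_algebraicClasses_iff (p := 2) f (openSubschemeOverι S U) hf W
    b').1 hb'

end Glue

/-- **The two stubs imply the crux, BY NAME.** Given the crux's data, S1 supplies affine opens
`U₀ ∋ pt s₀`, `U ∋ pt s` over which the total space is quasi-projective; they meet (irreducibility of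
`S`) in a Zariski open carrying a complex point `u` (`S` is Jacobson); `step_of_localTransport` (S2 +
the tree's locus theorem + Baire) moves algebraicity `s₀ → u` inside `U₀` and `u → s` inside `U`. -/
theorem RankFourWeilTransport_of (h₁ : Registered.stub_locallyProjective)
    (h₂ : Registered.stub_localTransport) :
    Summit.HodgeConjecture.HodgeConjecture.Theses.RankFourFaces.RankFourWeilTransport := by
  intro g hg P hPm hPd hPi hPr hPc 𝒳 S f hf hirr hsm hfib W hW hs₀ s
  obtain ⟨s₀, hs₀⟩ := hs₀
  haveI := hirr
  haveI := hsm
  -- the fibres are abelian varieties (forget the `E`-structure for S1)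
  have hab : ∀ t : ComplexPoints S, ∃ A' : AbelianVariety ℂ, Nonempty (A'.X ≅ fiberOver f t) :=
    fun t => by
      obtain ⟨A', -, -, -, hA'⟩ := hfib t
      exact ⟨A', hA'⟩
  -- S1: affine opens through `pt s₀` and `pt s` with quasi-projective total space above them
  obtain ⟨U₀, hU₀, hs₀U₀, hq₀⟩ := h₁ (4 * g) f hf hsm hab s₀
  obtain ⟨U, hU, hsU, hq⟩ := h₁ (4 * g) f hf hsm hab s
  -- a complex point over `U₀ ∩ U` (irreducible + Jacobson)
  have hne : ((U₀ : Set S.left) ∩ (U : Set S.left)).Nonempty := by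
    obtain ⟨x, -, hx⟩ := (PreirreducibleSpace.isPreirreducible_univ (X := S.left)) _ _ U₀.isOpen
      U.isOpen ⟨s₀.pt, Set.mem_univ _, hs₀U₀⟩ ⟨s.pt, Set.mem_univ _, hsU⟩
    exact ⟨x, hx⟩
  obtain ⟨u, huU₀, huU⟩ := exists_complexPoints_pt_mem_of_isOpen (S := S) (U₀.isOpen.inter U.isOpen)
    hne
  -- `s₀ → u` inside `U₀`, then `u → s` inside `U`
  exact step_of_localTransport h₂ hg hPm hPd hPi hPr hPc f hf hfib W hW U hU hq u s huU hsU
    (step_of_localTransport h₂ hg hPm hPd hPi hPr hPc f hf hfib W hW U₀ hU₀ hq₀ s₀ u hs₀U₀ huU₀ hs₀)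

/-- Wiring check: the registered stubs feed the composition as stated (definitional unfolding only). -/
example : Summit.HodgeConjecture.HodgeConjecture.Theses.RankFourFaces.RankFourWeilTransport :=
  RankFourWeilTransport_of stub_locallyProjective stub_localTransport

/-! ## §4 Plumbing sanity (proved): the converse direction crux ⇒ S2 is immediate (`V = S(ℂ)`), as for
any special case — recorded so that nobody mistakes S2 for an independent strengthening. -/
example (h : Summit.HodgeConjecture.HodgeConjecture.Theses.RankFourFaces.RankFourWeilTransport) :
    LocalTransport := by
  intro g hg P hPm hPd hPi hPr hPc 𝒳 S f hf _ _ hirr hsm hfib W hW hs₀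
  obtain ⟨s₀, hs₀⟩ := hs₀
  exact ⟨Set.univ, isOpen_univ, ⟨s₀, Set.mem_univ _⟩,
    fun t _ => h g hg P hPm hPd hPi hPr hPc f hf hirr hsm hfib W hW ⟨s₀, hs₀⟩ t⟩

end Summit.HodgeConjecture.HodgeConjecture.Cruxes.RankFourWeilTransport.Birth

end
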